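import Summits.ABC.ABC.Theses.IsogenyGlueCongruence
import Summits.ABC.ABC.Theorems.EllipticGluingPrimeBound.Negative.LoadBearing
import Summits.ABC.ABC.Theorems.IsogenyGlueCongruenceEllipticGluingPrimeBoundStubIsotypicDichotomy
import Literature.AlgebraicGeometry.Motives.AbelianVarietyQuotientGeomPoints
import Literature.AlgebraicGeometry.Motives.AbelianVarietyProductDimProofs
import Literature.NumberTheory.DiophantineGeometry.AVIsogenyQuasiInverse
import Literature.NumberTheory.DiophantineGeometry.AVIsogenyTateHomProofs
import Literature.NumberTheory.DiophantineGeometry.AVGeomPointsDivisibleProofs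
import Literature.NumberTheory.DiophantineGeometry.AVGaloisModuleContinuityProofs
import Literature.AlgebraicGeometry.Motives.AbelianVarietyEndAlgebraSemisimpleProofs
import Literature.AlgebraicGeometry.Motives.TateAbelianFiniteLatticeProofs
import Literature.AlgebraicGeometry.Motives.AbelianVarietyPoincareCompleteReducibility
import Literature.AlgebraicGeometry.Motives.AbelianVarietyKernelComponent
import Literature.NumberTheory.DiophantineGeometry.AVIsogenyTateHomPoincareProofs
import HarnessLib

/-!
# Crux U `EllipticGluingPrimeBound` (stmt-ABC-13919): the CONVERSE reduction `U → U_free`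

Line `Sketch` of crux U `Summit.ABC.ABC.Theses.IsogenyGlueCongruence.EllipticGluingPrimeBound`
reduced the crux to its residual registered stub `stub_geomFreeTorsionBound` (`U_free`:
height-free torsion sharing with GEOMETRICALLY `E`-FREE partners) plus named facts
(`ellipticGluingPrimeBound_of_free`, …EllipticGluingPrimeBoundOfFree.lean). This file proves
the CONVERSE unconditionally, with the same `κ` and `C`:

* `geomFreeTorsionBound_of_ellipticGluingPrimeBound : EllipticGluingPrimeBound → U_free`.

So `U_free` is EQUIVALENT to the crux modulo the named facts: the residual stub is crux-sized
and any line for U must prove it (the `⟸` half of the structural reduction of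
`Cruxes/EllipticGluingPrimeBound/Disproof.lean` §2, previously on paper only).

## The gluing construction (`exists_gluing`)

For an elliptic `W/ℚ` with AV-model `(E, e)`, a geometrically `E`-free `A/ℚ`, a prime `ℓ` and
an equivariant embedding `ι : W[ℓ] ↪ A(ℚ̄)`, the graph `S = {inl x + inr ι(e x) : x ∈ E[ℓ]}`
in `(E ⊞ A)(ℚ̄)` is finite, `Γ_ℚ`-stable and killed by `[ℓ]`; the tree's quotient theorem
`AbelianVariety.exists_isogeny_geomKer_eq_of_isIsogeny` (Mumford §7 Thm. 4) yields an isogeny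
`h : E ⊞ A → B` over `ℚ` with `ker h(ℚ̄) = S`. Then `dim B = dim A + 1`, `(inl ≫ h, g ≫ fst)`
is a non-zero multiplier (`exists_multiplier_of_gluing`), and every multiplier is divisible by
`ℓ`:

* `dvd_multiplier_of_gluing` — the point-level heart. With `g ≫ h = N`: `Hom(E, A) = 0` forces
  `α ≫ g = φ ≫ inl`, so `N • α = φ ≫ inl ≫ h`; `Hom(A, E) = 0` forces `inr ≫ h ≫ β = 0`, so
  `χ = inl ≫ h ≫ β` kills `E[ℓ]` (as `h(inl t + inr ι e t) = 0`); `φ` kills `E[N]` (as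
  `inl y ∈ ker h ⇒ y = 0`). For `0 ≠ t₀ ∈ E[ℓ]` write `t₀ = N x'` (divisibility): then
  `n t₀ = χ(φ x')` and `ℓ φ(x') = φ(ℓ x') = 0`, so `n t₀ = 0` and `ℓ ∣ n`. No `End E` input.
* `hom_eq_zero_of_geomFree` — `Hom(E_ℚ̄, A_ℚ̄) = 0 ⇒ Hom_ℚ(A, E) = 0`: faithful base change
  (`Hom.baseChange_injective`) and, over `ℚ̄`, complete reducibility up to isogeny
  (`exists_quasiDecomposition_of_isogeny_biprod` with Poincaré's theorem `poincare_hP1`) plus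
  `hsimple_of_isAlgClosed` (non-zero maps of simple abelian varieties are isogenies).

Unconditional (no named fact, no `sorry`); lands `--supports stmt-ABC-13919`.
-/


noncomputable section

-- `Summit.<Summit>.<Problem>` is the mandated summit-side namespace (CONVENTIONS §2); for the
-- single-conjunct summit `ABC` the two coincide, so the duplicate `ABC.ABC` is deliberate.
set_option linter.dupNamespace false

namespace Summit.ABC.ABC.Theorems.IsotypicMinkowski

open CategoryTheory CategoryTheory.Limits AlgebraicGeometry
open Literature.AlgebraicGeometry.Motives
open Summit.ABC.ABC.Theses.IsogenyGlueCongruence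

/-- **Multipliers of a gluing are divisible by `ℓ`.** Abstract form: `h : E ⊞ A ⟶ B` an isogeny
whose kernel on `ℚ̄`-points meets `inl(E)` trivially and contains, for every `t ∈ E[ℓ]`, a
point `inl t + inr a`; `Hom(E, A) = 0 = Hom(A, E)`; `E[ℓ] ≠ 0`; `E(ℚ̄)` divisible. Then `ℓ`
divides every `E`-multiplier of `B`. -/
theorem dvd_multiplier_of_gluing {E A B : AbelianVariety.{0} ℚ} (h : E ⊞ A ⟶ B)
    (hh : AbelianVariety.IsIsogeny h) {ℓ : ℕ} (hℓ : ℓ.Prime)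
    (hinl : ∀ y : E.geomPoints,
      AbelianVariety.Hom.geomPointsMap (biprod.inl ≫ h) y = 0 → y = 0)
    (hT : ∀ t : E.geomPoints, (ℓ : ℤ) • t = 0 → ∃ a : A.geomPoints,
      AbelianVariety.Hom.geomPointsMap (biprod.inl ≫ h) t =
        AbelianVariety.Hom.geomPointsMap (biprod.inr ≫ h) a)
    (hT0 : ∃ t : E.geomPoints, (ℓ : ℤ) • t = 0 ∧ t ≠ 0)
    (hdiv : ∀ (N : ℕ), 0 < N → ∀ x : E.geomPoints, ∃ y : E.geomPoints, (N : ℤ) • y = x)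
    (hEA : ∀ f : E ⟶ A, f = 0) (hAE : ∀ f : A ⟶ E, f = 0)
    (α : E ⟶ B) (β : B ⟶ E) (n : ℤ) (hαβ : α ≫ β = n • 𝟙 E) : (ℓ : ℤ) ∣ n := by
  obtain ⟨g, N, hN, -, hgh⟩ := AbelianVariety.IsIsogeny.exists_nsmul_inverse_holds hh
  have hmap : ∀ {X Y : AbelianVariety.{0} ℚ} (f : X ⟶ Y) (m : ℤ) (x : X.geomPoints),
      AbelianVariety.Hom.geomPointsMap (m • f) x = m • AbelianVariety.Hom.geomPointsMap f x := by
    intro X Y f m x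
    rw [← AbelianVariety.Hom.geomPointsMapAddMonoidHom_apply, map_zsmul,
      AbelianVariety.Hom.geomPointsMapAddMonoidHom_apply, AddMonoidHom.smul_apply]
  have hcomp : ∀ {X Y Z : AbelianVariety.{0} ℚ} (f : X ⟶ Y) (f' : Y ⟶ Z) (x : X.geomPoints),
      AbelianVariety.Hom.geomPointsMap (f ≫ f') x =
        AbelianVariety.Hom.geomPointsMap f' (AbelianVariety.Hom.geomPointsMap f x) := by
    intro X Y Z f f' x
    rw [AbelianVariety.Hom.geomPointsMap_comp, AddMonoidHom.comp_apply]
  -- `α ≫ g` has no `A`-component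
  set φ : E ⟶ E := α ≫ g ≫ biprod.fst with hφ
  have hαg : α ≫ g = φ ≫ biprod.inl := by
    have htot := biprod.total (X := E) (Y := A)
    have h0 : (α ≫ g) ≫ biprod.snd = 0 := by rw [Category.assoc]; exact hEA _
    calc α ≫ g = (α ≫ g) ≫ 𝟙 (E ⊞ A) := (Category.comp_id _).symm
      _ = (α ≫ g) ≫ (biprod.fst ≫ biprod.inl + biprod.snd ≫ biprod.inr) := by rw [htot]
      _ = φ ≫ biprod.inl := by
        rw [Preadditive.comp_add, ← Category.assoc, ← Category.assoc, h0, zero_comp, add_zero, hφ]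
        simp only [Category.assoc]
  -- `N • α = φ ≫ inl ≫ h`
  have hNα : (N : ℤ) • α = φ ≫ biprod.inl ≫ h := by
    have h1 : α ≫ g ≫ h = φ ≫ biprod.inl ≫ h := by rw [← Category.assoc, hαg, Category.assoc]
    rw [hgh, show (N • 𝟙 B : B ⟶ B) = (N : ℤ) • 𝟙 B from (natCast_zsmul _ _).symm,
      Preadditive.comp_zsmul, Category.comp_id] at h1
    exact h1
  -- `χ := inl ≫ h ≫ β` kills `E[ℓ]`
  set χ : E ⟶ E := biprod.inl ≫ h ≫ β with hχ
  have hinr0 : biprod.inr ≫ h ≫ β = 0 := hAE _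
  have hχT : ∀ t : E.geomPoints, (ℓ : ℤ) • t = 0 → AbelianVariety.Hom.geomPointsMap χ t = 0 := by
    intro t ht
    obtain ⟨a, ha⟩ := hT t ht
    have h1 : AbelianVariety.Hom.geomPointsMap χ t =
        AbelianVariety.Hom.geomPointsMap (biprod.inr ≫ h ≫ β) a := by
      rw [hχ, ← Category.assoc, hcomp, ha, ← hcomp, Category.assoc]
    rw [h1, hinr0, AbelianVariety.Hom.geomPointsMap_zero, AddMonoidHom.zero_apply]
  -- `φ` kills `E[N]`
  have hφN : ∀ d : E.geomPoints, (N : ℤ) • d = 0 → AbelianVariety.Hom.geomPointsMap φ d = 0 := by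
    intro d hd
    apply hinl
    rw [← hcomp, ← hNα, hmap, ← map_zsmul, hd, map_zero]
  -- conclusion on a non-zero `ℓ`-torsion point
  obtain ⟨t₀, ht₀ℓ, ht₀⟩ := hT0
  obtain ⟨x', hx'⟩ := hdiv N hN t₀
  have hn : n • t₀ = AbelianVariety.Hom.geomPointsMap χ (AbelianVariety.Hom.geomPointsMap φ x') := by
    have h1 : n • t₀ = AbelianVariety.Hom.geomPointsMap (α ≫ β) t₀ := by
      rw [hαβ, EllipticGluingPrimeBound.Negative.geomPointsMap_zsmul_id]; rfl
    rw [h1, hcomp, ← hx', map_zsmul, ← hmap, hNα, hχ, hcomp, hcomp, hcomp, hcomp, hcomp, hcomp]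
  have hφx' : (ℓ : ℤ) • AbelianVariety.Hom.geomPointsMap φ x' = 0 := by
    rw [← map_zsmul]
    apply hφN
    rw [smul_comm, hx', ht₀ℓ]
  rw [hχT _ hφx'] at hn
  -- `n • t₀ = 0`, `ℓ • t₀ = 0`, `t₀ ≠ 0` ⟹ `ℓ ∣ n`
  by_contra hnd
  have hcop : IsCoprime (ℓ : ℤ) n := by
    rw [Int.isCoprime_iff_gcd_eq_one]
    change Nat.gcd (ℓ : ℤ).natAbs n.natAbs = 1
    rw [Int.natAbs_natCast]
    exact (Nat.Prime.coprime_iff_not_dvd hℓ).2 fun h' ↦ hnd (Int.natCast_dvd.2 h')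
  obtain ⟨u, v, huv⟩ := hcop
  apply ht₀
  calc t₀ = (1 : ℤ) • t₀ := (one_zsmul _).symm
    _ = (u * ℓ + v * n) • t₀ := by rw [huv]
    _ = 0 := by rw [add_zsmul, mul_zsmul, mul_zsmul, ht₀ℓ, hn, zsmul_zero, zsmul_zero, add_zero]

/-- **Geometric `E`-freeness is symmetric in the direction we need**: if `dim E = 1` and
`Hom(E_ℚ̄, A_ℚ̄) = 0` then `Hom_ℚ(A, E) = 0`.  A non-zero `f : A → E` stays non-zero over `ℚ̄`
(base change is faithful); over `ℚ̄`, complete reducibility up to isogeny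
(`exists_quasiDecomposition_of_isogeny_biprod` with Poincaré's theorem `poincare_hP1`) writes
`N • 𝟙 = ∑ πᵢ ≫ ιᵢ` through simple `Sᵢ`, so some `ιᵢ ≫ f_ℚ̄ : Sᵢ → E_ℚ̄` is non-zero, hence an
isogeny (`hsimple_of_isAlgClosed`, `E_ℚ̄` being simple of dimension `1`); a quasi-inverse `u` gives
`u ≫ ιᵢ : E_ℚ̄ → A_ℚ̄` with `(u ≫ ιᵢ) ≫ f_ℚ̄ = n • 𝟙 ≠ 0`, contradicting freeness. -/
theorem hom_eq_zero_of_geomFree {E A : AbelianVariety.{0} ℚ} (hE : E.dim = 1)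
    (hfree : ∀ f : E.baseChange (AlgebraicClosure ℚ) ⟶ A.baseChange (AlgebraicClosure ℚ), f = 0)
    (f : A ⟶ E) : f = 0 := by
  classical
  by_contra hf
  let L := AlgebraicClosure ℚ
  set f' : A.baseChange L ⟶ E.baseChange L := AbelianVariety.Hom.baseChange L f with hf'def
  have hbc0 : AbelianVariety.Hom.baseChange L (0 : A ⟶ E) = 0 := by
    have h := AbelianVariety.Hom.baseChange_add L (0 : A ⟶ E) 0
    rw [add_zero] at h
    exact left_eq_add.1 h
  have hf' : f' ≠ 0 := fun h0 ↦ hf (AbelianVariety.Hom.baseChange_injective L (h0.trans hbc0.symm))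
  -- Poincaré's theorem over `L` in splitting form
  have hP : ∀ X : AbelianVariety L, ¬ AbelianVariety.IsSimple X → ∃ X₁ X₂ : AbelianVariety L,
      X₁.dim < X.dim ∧ X₂.dim < X.dim ∧ ∃ σ : X₁ ⊞ X₂ ⟶ X, AbelianVariety.IsIsogeny σ := by
    intro X hX
    have hY : ∃ (Y : AbelianVariety L) (i : Y ⟶ X),
        IsClosedImmersion (AbelianVariety.Hom.toSchemeHom i) ∧ 0 < Y.dim ∧ Y.dim < X.dim := by
      by_contra hne
      exact hX fun B g h1 h2 h3 ↦ hne ⟨B, g, h1, h2, h3⟩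
    obtain ⟨Y, i, hi, hY0, hYX⟩ := hY
    obtain ⟨Z, j, -, hσ⟩ := AbelianVariety.poincare_hP1 L X Y i hi hY0 hYX
    have hdim : Y.dim + Z.dim = X.dim := by
      rw [← AbelianVariety.dim_biprod]
      exact AbelianVariety.dim_eq_of_isIsogeny hσ
    exact ⟨Y, Z, hYX, by omega, _, hσ⟩
  obtain ⟨I, _, S, ι, π, N, hS, hN, -, -, h3⟩ :=
    AbelianVariety.exists_quasiDecomposition_of_isogeny_biprod hP (A.baseChange L)
  -- `N • f' ≠ 0`
  have hNf : (N • 𝟙 (A.baseChange L)) ≫ f' ≠ 0 := by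
    intro h0
    have hN' : ((N : ℕ) : L) ≠ 0 := by exact_mod_cast hN.ne'
    exact hf' ((AbelianVariety.isIsogeny_nsmul_id_of_cast_ne_zero (A.baseChange L) N hN').cancel_left
      (h0.trans comp_zero.symm))
  rw [← h3, Preadditive.sum_comp] at hNf
  obtain ⟨i, hi⟩ : ∃ i, (π i ≫ ι i) ≫ f' ≠ 0 := by
    by_contra hne
    push Not at hne
    exact hNf (Finset.sum_eq_zero fun i _ ↦ hne i)
  have hιf : ι i ≫ f' ≠ 0 := fun h0 ↦ hi (by rw [Category.assoc, h0, comp_zero])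
  have hEs : AbelianVariety.IsSimple (E.baseChange L) :=
    AbelianVariety.isSimple_of_dim_le_one (by rw [AbelianVariety.dim_baseChange, hE])
  have hiso : AbelianVariety.IsIsogeny (ι i ≫ f') :=
    AbelianVariety.hsimple_of_isAlgClosed L (S i) (E.baseChange L) (hS i) hEs _ hιf
  obtain ⟨u, n, hn, -, hu⟩ := AbelianVariety.IsIsogeny.exists_nsmul_inverse_holds hiso
  have hu0 : u ≫ ι i = 0 := hfree _
  have hn0 : (n • 𝟙 (E.baseChange L)) = 0 := by
    rw [← hu, ← Category.assoc, hu0, zero_comp]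
  have hn' : ((n : ℕ) : L) ≠ 0 := by exact_mod_cast hn.ne'
  have hz : AbelianVariety.IsIsogeny (0 : E.baseChange L ⟶ E.baseChange L) := by
    rw [← hn0]; exact AbelianVariety.isIsogeny_nsmul_id_of_cast_ne_zero _ n hn'
  have h1 : (𝟙 (E.baseChange L)) = 0 := hz.cancel_left (by rw [zero_comp, zero_comp])
  exact hf' (by rw [← Category.comp_id f', h1, comp_zero])

/-- **A gluing has a non-zero `E`-multiplier**: for an isogeny `h : E ⊞ A → B` with quasi-inverse
`g` (`h ≫ g = N • 𝟙`), `(inl ≫ h) ≫ (g ≫ fst) = N • 𝟙 E`. -/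
theorem exists_multiplier_of_gluing {E A B : AbelianVariety.{0} ℚ} (h : E ⊞ A ⟶ B)
    (hh : AbelianVariety.IsIsogeny h) :
    ∃ (α : E ⟶ B) (β : B ⟶ E) (n : ℤ), n ≠ 0 ∧ α ≫ β = n • 𝟙 E := by
  obtain ⟨g, N, hN, hhg, -⟩ := AbelianVariety.IsIsogeny.exists_nsmul_inverse_holds hh
  refine ⟨biprod.inl ≫ h, g ≫ biprod.fst, N, by exact_mod_cast hN.ne', ?_⟩
  rw [Category.assoc, ← Category.assoc h, hhg, Preadditive.nsmul_comp, Category.id_comp,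
    Preadditive.comp_nsmul, biprod.inl_fst, natCast_zsmul]

/-- **The gluing construction.** Let `W/ℚ` be an elliptic curve with AV-model `(E, e)`, `A/ℚ`
geometrically `E`-free, `ℓ` a prime and `ι : W[ℓ] ↪ A(ℚ̄)` a `Γ_ℚ`-equivariant embedding. The graph
`S = {inl x + inr ι(e x) : x ∈ E[ℓ]} ≤ (E ⊞ A)(ℚ̄)` is finite, `Γ_ℚ`-stable and killed by `[ℓ]`, so
the tree's quotient theorem (`exists_isogeny_geomKer_eq_of_isIsogeny`, Mumford §7 Thm. 4) gives an
isogeny `h : E ⊞ A → B` over `ℚ` with `ker h(ℚ̄) = S`. Then `dim B = dim A + 1`, `(E, B)` has a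
non-zero multiplier, and EVERY `E`-multiplier of `B` is divisible by `ℓ`
(`dvd_multiplier_of_gluing`, with `Hom(E, A) = 0` by faithfulness of base change and
`Hom(A, E) = 0` by `hom_eq_zero_of_geomFree`). -/
theorem exists_gluing {W : WeierstrassCurve ℚ} [W.IsElliptic] {E A : AbelianVariety.{0} ℚ}
    (e : E.geomPoints ≃+ W.geomPoints)
    (he : ∀ (σ : Field.absoluteGaloisGroup ℚ) (P : E.geomPoints), e (σ • P) = σ • e P)
    (hfree : ∀ f : E.baseChange (AlgebraicClosure ℚ) ⟶ A.baseChange (AlgebraicClosure ℚ), f = 0)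
    {ℓ : ℕ} (hℓ : ℓ.Prime) (ι : W.geomTorsion ℓ →+ A.geomPoints) (hι : Function.Injective ι)
    (hιe : ∀ (σ : Field.absoluteGaloisGroup ℚ) (P : W.geomTorsion ℓ), ι (σ • P) = σ • ι P) :
    ∃ B : AbelianVariety.{0} ℚ, B.dim = A.dim + 1 ∧
      (∃ (α : E ⟶ B) (β : B ⟶ E) (n : ℤ), n ≠ 0 ∧ α ≫ β = n • 𝟙 E) ∧
      (∀ (α : E ⟶ B) (β : B ⟶ E) (n : ℤ), α ≫ β = n • 𝟙 E → (ℓ : ℤ) ∣ n) := by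
  classical
  have hE : E.dim = 1 := dim_eq_one_of_equiv e
  have hℓ0 : ((ℓ : ℤ) : ℚ) ≠ 0 := by exact_mod_cast hℓ.ne_zero
  -- `e` restricted to `ℓ`-torsion, and the gluing datum `j = ι ∘ e` on `E[ℓ]`
  let eT : E.geomTorsion ℓ →+ W.geomTorsion ℓ :=
    AddMonoidHom.codRestrict (e.toAddMonoidHom.comp (E.geomTorsion ℓ).subtype) (W.geomTorsion ℓ)
      (fun x ↦ (map_mem_geomTorsion_iff e ℓ x).2 x.2)
  have heT : ∀ x : E.geomTorsion ℓ, (eT x : W.geomPoints) = e x := fun x ↦ rfl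
  have heT_inj : Function.Injective eT := by
    intro x y hxy
    apply Subtype.ext
    apply e.injective
    rw [← heT, ← heT, hxy]
  let j : E.geomTorsion ℓ →+ A.geomPoints := ι.comp eT
  have hj_inj : Function.Injective j := hι.comp heT_inj
  -- the graph `S`
  let inlP := AbelianVariety.Hom.geomPointsMap (biprod.inl : E ⟶ E ⊞ A)
  let inrP := AbelianVariety.Hom.geomPointsMap (biprod.inr : A ⟶ E ⊞ A)
  let fstP := AbelianVariety.Hom.geomPointsMap (biprod.fst : E ⊞ A ⟶ E)
  let sndP := AbelianVariety.Hom.geomPointsMap (biprod.snd : E ⊞ A ⟶ A)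
  let s : E.geomTorsion ℓ →+ (E ⊞ A).geomPoints := inlP.comp (E.geomTorsion ℓ).subtype + inrP.comp j
  have hs : ∀ x : E.geomTorsion ℓ, s x = inlP x + inrP (j x) := fun x ↦ rfl
  let S : AddSubgroup (E ⊞ A).geomPoints := s.range
  -- biproduct identities on points
  have hcomp : ∀ {X Y Z : AbelianVariety.{0} ℚ} (f : X ⟶ Y) (f' : Y ⟶ Z) (x : X.geomPoints),
      AbelianVariety.Hom.geomPointsMap (f ≫ f') x =
        AbelianVariety.Hom.geomPointsMap f' (AbelianVariety.Hom.geomPointsMap f x) := by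
    intro X Y Z f f' x
    rw [AbelianVariety.Hom.geomPointsMap_comp, AddMonoidHom.comp_apply]
  have hfst_inl : ∀ y : E.geomPoints, fstP (inlP y) = y := fun y ↦ by
    change AbelianVariety.Hom.geomPointsMap biprod.fst (AbelianVariety.Hom.geomPointsMap biprod.inl y) = y
    rw [← hcomp, biprod.inl_fst, AbelianVariety.Hom.geomPointsMap_id, AddMonoidHom.id_apply]
  have hsnd_inl : ∀ y : E.geomPoints, sndP (inlP y) = 0 := fun y ↦ by
    change AbelianVariety.Hom.geomPointsMap biprod.snd (AbelianVariety.Hom.geomPointsMap biprod.inl y) = 0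
    rw [← hcomp, biprod.inl_snd, AbelianVariety.Hom.geomPointsMap_zero, AddMonoidHom.zero_apply]
  have hsnd_inr : ∀ a : A.geomPoints, sndP (inrP a) = a := fun a ↦ by
    change AbelianVariety.Hom.geomPointsMap biprod.snd (AbelianVariety.Hom.geomPointsMap biprod.inr a) = a
    rw [← hcomp, biprod.inr_snd, AbelianVariety.Hom.geomPointsMap_id, AddMonoidHom.id_apply]
  -- finiteness, stability, killed by `[ℓ]`
  haveI : Finite (E.geomTorsion ℓ) := E.finite_geomTorsion_of_cast_ne_zero (ℓ : ℤ) hℓ0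
  have hSfin : (S : Set (E ⊞ A).geomPoints).Finite := by
    change (Set.range s).Finite
    exact Set.finite_range _
  have hSstab : ∀ (σ : Field.absoluteGaloisGroup ℚ) (z : (E ⊞ A).geomPoints), z ∈ S → σ • z ∈ S := by
    rintro σ z ⟨x, rfl⟩
    have hσx : σ • (x : E.geomPoints) ∈ E.geomTorsion ℓ := AbelianVariety.smul_mem_geomTorsion σ x.2
    refine ⟨⟨σ • (x : E.geomPoints), hσx⟩, ?_⟩
    have hjσ : j ⟨σ • (x : E.geomPoints), hσx⟩ = σ • j x := by
      change ι (eT ⟨σ • (x : E.geomPoints), hσx⟩) = σ • ι (eT x)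
      rw [← hιe]
      congr 1
      apply Subtype.ext
      rw [heT, Literature.NumberTheory.EllipticCurves.AddSubgroup.torsionBy.coe_smul, heT]
      exact he σ x
    rw [hs, hs, smul_add, hjσ]
    change inlP (σ • (x : E.geomPoints)) + _ = _
    rw [AbelianVariety.Hom.geomPointsMap_smul, AbelianVariety.Hom.geomPointsMap_smul]
  have hq : AbelianVariety.IsIsogeny ((ℓ : ℤ) • 𝟙 (E ⊞ A)) :=
    AbelianVariety.isIsogeny_zsmul_id_of_cast_ne_zero (A := E ⊞ A) (ℓ : ℤ) hℓ0
  have hSq : ∀ z ∈ S, AbelianVariety.Hom.geomPointsMap ((ℓ : ℤ) • 𝟙 (E ⊞ A)) z = 0 := by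
    rintro z ⟨x, rfl⟩
    rw [EllipticGluingPrimeBound.Negative.geomPointsMap_zsmul_id]
    change (ℓ : ℤ) • s x = 0
    rw [← map_zsmul]
    have hx0 : (ℓ : ℤ) • x = 0 := by
      apply Subtype.ext
      exact (AbelianVariety.mem_geomTorsion_iff' (x : E.geomPoints)).1 x.2
    rw [hx0, map_zero]
  -- the quotient
  obtain ⟨B, h, hh, hker, -⟩ :=
    AbelianVariety.exists_isogeny_geomKer_eq_of_isIsogeny (E ⊞ A) S hSfin hSstab _ hq hSq
  refine ⟨B, ?_, exists_multiplier_of_gluing h hh, ?_⟩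
  · rw [← AbelianVariety.dim_eq_of_isIsogeny hh, AbelianVariety.dim_biprod, hE, add_comm]
  -- the hypotheses of `dvd_multiplier_of_gluing`
  have hEA : ∀ f : E ⟶ A, f = 0 := by
    intro f
    have hbc0 : AbelianVariety.Hom.baseChange (AlgebraicClosure ℚ) (0 : E ⟶ A) = 0 := by
      have h0 := AbelianVariety.Hom.baseChange_add (AlgebraicClosure ℚ) (0 : E ⟶ A) 0
      rw [add_zero] at h0
      exact left_eq_add.1 h0
    exact AbelianVariety.Hom.baseChange_injective (AlgebraicClosure ℚ) ((hfree _).trans hbc0.symm)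
  have hAE : ∀ f : A ⟶ E, f = 0 := hom_eq_zero_of_geomFree hE hfree
  have hinl : ∀ y : E.geomPoints,
      AbelianVariety.Hom.geomPointsMap (biprod.inl ≫ h) y = 0 → y = 0 := by
    intro y hy
    rw [hcomp] at hy
    obtain ⟨x, hx⟩ := (hker _).1 hy
    have h1 : j x = 0 := by
      have h2 := congrArg sndP hx
      rw [hs, map_add, hsnd_inl, hsnd_inr, zero_add] at h2
      rw [h2]
      exact hsnd_inl y
    have hx0 : x = 0 := hj_inj (by rw [h1, map_zero])
    rw [hx0, map_zero] at hx
    rw [← hfst_inl y]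
    change fstP (AbelianVariety.Hom.geomPointsMap biprod.inl y) = 0
    rw [← hx, map_zero]
  have hT : ∀ t : E.geomPoints, (ℓ : ℤ) • t = 0 → ∃ a : A.geomPoints,
      AbelianVariety.Hom.geomPointsMap (biprod.inl ≫ h) t =
        AbelianVariety.Hom.geomPointsMap (biprod.inr ≫ h) a := by
    intro t ht
    have htmem : t ∈ E.geomTorsion ℓ := (AbelianVariety.mem_geomTorsion_iff' t).2 ht
    refine ⟨-(j ⟨t, htmem⟩), ?_⟩
    have h0 : AbelianVariety.Hom.geomPointsMap h (s ⟨t, htmem⟩) = 0 := (hker _).2 ⟨_, rfl⟩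
    rw [hs, map_add] at h0
    rw [hcomp, hcomp, map_neg, map_neg]
    exact eq_neg_of_add_eq_zero_left h0
  have hT0 : ∃ t : E.geomPoints, (ℓ : ℤ) • t = 0 ∧ t ≠ 0 := by
    have hcard : Nat.card (W.geomTorsion ℓ) = ℓ ^ 2 := by
      have hc := Literature.NumberTheory.EllipticCurves.natCard_geomTorsion_int_eq_sq W
        (n := (ℓ : ℤ)) (by exact_mod_cast hℓ.ne_zero)
      rwa [Int.natAbs_natCast] at hc
    haveI : Finite (W.geomTorsion ℓ) :=
      Nat.finite_of_card_ne_zero (by rw [hcard]; exact pow_ne_zero 2 hℓ.ne_zero)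
    have h1 : 1 < Nat.card (W.geomTorsion ℓ) := by
      rw [hcard]
      exact Nat.one_lt_pow two_ne_zero hℓ.one_lt
    haveI : Nontrivial (W.geomTorsion ℓ) := Finite.one_lt_card_iff_nontrivial.1 h1
    obtain ⟨P, hP⟩ := exists_ne (0 : W.geomTorsion ℓ)
    refine ⟨e.symm P, ?_, fun h0 ↦ hP ?_⟩
    · have hmem : e.symm (P : W.geomPoints) ∈ E.geomTorsion ℓ := by
        rw [← map_mem_geomTorsion_iff e ℓ, e.apply_symm_apply]; exact P.2
      exact (AbelianVariety.mem_geomTorsion_iff' _).1 hmem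
    · apply Subtype.ext
      have := congrArg e h0
      rwa [e.apply_symm_apply, map_zero] at this
  have hdiv : ∀ (N : ℕ), 0 < N → ∀ x : E.geomPoints, ∃ y : E.geomPoints, (N : ℤ) • y = x := by
    intro N hN x
    obtain ⟨y, hy⟩ := AbelianVariety.nsmul_geomPoints_surjective_of_ne_zero (A := E) N hN.ne' x
    exact ⟨y, by rw [natCast_zsmul]; exact hy⟩
  intro α β n hαβ
  exact dvd_multiplier_of_gluing h hh hℓ hinl hT hT0 hdiv hEA hAE α β n hαβ

/-- **The converse reduction `U → U_free`**: the crux `EllipticGluingPrimeBound` implies the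
residual stub `stub_geomFreeTorsionBound` of line Sketch (height-free torsion sharing with
geometrically `E`-free partners), with the SAME exponent and constant: glue `E` to `A` along
`W[ℓ] ↪ A(ℚ̄)` (`exists_gluing`) and read the crux's bound for `B = (E ⊞ A)/graph`,
`dim B = dim A + 1`.  Together with the landed reduction `ellipticGluingPrimeBound_of_free`
(p115578: named facts + `U_free` ⟹ U) this shows that `U_free` is EQUIVALENT to the crux modulo
the named facts, i.e. the residual stub of the line is crux-sized (Disproof §2, now formal). -/
theorem geomFreeTorsionBound_of_ellipticGluingPrimeBound (hU : EllipticGluingPrimeBound) :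
    ∃ κ C : ℝ, 0 ≤ κ ∧ ∀ (W : WeierstrassCurve ℚ) [W.IsElliptic] (E A : AbelianVariety.{0} ℚ)
      (e : E.geomPoints ≃+ W.geomPoints),
      (∀ (σ : Field.absoluteGaloisGroup ℚ) (P : E.geomPoints), e (σ • P) = σ • e P) →
      (∀ f : E.baseChange (AlgebraicClosure ℚ) ⟶ A.baseChange (AlgebraicClosure ℚ), f = 0) →
      ∀ ℓ : ℕ, ℓ.Prime →
      (∃ ι : W.geomTorsion ℓ →+ A.geomPoints, Function.Injective ι ∧
        ∀ (σ : Field.absoluteGaloisGroup ℚ) (P : W.geomTorsion ℓ), ι (σ • P) = σ • ι P) →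
        (ℓ : ℝ) ≤ C * (((A.dim : ℝ) + 1) * max 1 W.stableFaltingsHeight) ^ κ := by
  obtain ⟨κ, C, hκ, hU⟩ := hU
  refine ⟨κ, C, hκ, ?_⟩
  intro W _ E A e he hfree ℓ hℓ hι
  obtain ⟨ι, hι, hιe⟩ := hι
  obtain ⟨B, hdim, hex, hall⟩ := exists_gluing e he hfree hℓ ι hι hιe
  have hB := hU W E B e he ℓ hℓ hex hall
  have hcast : ((B.dim : ℕ) : ℝ) = (A.dim : ℝ) + 1 := by rw [hdim]; push_cast; ring
  rwa [hcast] at hB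

end Summit.ABC.ABC.Theorems.IsotypicMinkowski

end
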